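import Literature.Analysis.FluidPDE.KNSSLiouville
import Literature.Analysis.FluidPDE.KatoUniquenessDual
import Literature.Analysis.FluidPDE.AncientMildPairing
import HarnessLib

/-!
# Bounded ancient mild solutions are bounded weak solutions (mild ⇒ weak in `L^∞`)

Analysis/FluidPDE support file (all results proved) for the named fact
`Literature.Analysis.FluidPDE.knss_bound_C_over_r` (`SelfSimilarLiouville`; Koch–Nadirashvili–
Seregin–Šverák 2009, Theorem 5.3) and its companion `Literature.Analysis.FluidPDE.KNSSLiouville`.
The fact renders Theorem 5.3 in the tree's *duality-form* class of bounded ancient mild solutions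
(`Fluid.IsBoundedAncientMildSolution`: the two-time identity of Fabes–Jones–Rivière tested against
the caloric fields `e^{ν(t-τ)Δ}φ`, `φ ∈ C_c^∞` divergence free, between all `s < t < 0`), whereas
the theorem in print (`Literature.Analysis.FluidPDE.KNSS2009_liouville_bound_C_over_r`) concerns
KNSS's **bounded weak solutions** `u ∈ L^∞(ℝⁿ × (-∞, 0))`
(`Literature.Analysis.FluidPDE.IsBoundedWeakNSSolutionOn`: `div u = 0` and
`∫∫ u·(∂ₜψ + Δψ) = -∫∫ u_k u·∂_k ψ` for all smooth compactly supported divergence-free space–time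
fields `ψ`, arXiv:0709.3599, §4 (ii), p. 8). This file proves the analytic half of the bridge
between the two classes:

* `Literature.Analysis.FluidPDE.IsBoundedAncientMildSolution.isBoundedWeakNSSolutionOn`
  (**mild ⇒ weak in `L^∞`**): a bounded ancient mild solution (`0 < ν`) which is jointly a.e.
  strongly measurable on `(-∞, 0) × E` with measurable slices is a bounded weak solution on
  `ℝⁿ × (-∞, 0)` in the sense of KNSS (Fabes–Jones–Rivière 1972, Thm. 2.1, direction (ii) ⇒ (i),
  for the `L^∞` class of KNSS 2009, §4 (i)–(ii)).

What remains of the bridge (recorded in `KNSSLiouville`, "Why this file") is measure theoretic: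
to produce, for an arbitrary family `u` in the duality-form class with measurable slices and the
decay `r‖u‖ ≤ C`, a jointly measurable modification `w` with `w t = u t` a.e. for every `t < 0`
(to which this theorem applies), and to transport hypotheses and conclusion between `u` and `w`.

## Proof (testing the duality identity with `∂ₜψ + νΔψ` and integrating in time)

Let `ψ` be a space–time test field on the open slab with divergence-free slices, time support
in `[a', b]`, `b < 0`, and put `a = a' - 1`, `Λ = ∂ₜψ + νΔψ` (a space–time test field with
divergence-free slices: `IsSpaceTimeTestOn.heatAdjointField_top`,
`isDivFree_laplacian_of_contDiff`, `IsSpaceTimeTestOn.isDivFree_timeDeriv`). For `t ∈ (a, b]`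
the two-time identity between `a` and `t` tested with `Λ(t)` reads
`⟨u(t), Λ(t)⟩ - ⟨u(a), e^{ν(t-a)Δ}Λ(t)⟩ = ∫ₐᵗ ⟨u(τ), (u(τ)·∇) e^{ν(t-τ)Δ}Λ(t)⟩ dτ`, i.e. the slab
integral of `⟪u, K_t u⟫` with the transport kernel `K_t(τ, x) = 1_{τ<t} D(e^{ν(t-τ)Δ}Λ(t))(x)` of
`KatoUniquenessDual` (`IsAncientMildSolution.integral_inner_sub_eq_slab`). Integrate over
`t ∈ (a, b]`:
* the free term gives `∫⟨u(a), e^{ν(t-a)Δ}Λ(t)⟩ dt = ⟨u(a), 𝒰[Λ](a)⟩ = -⟨u(a), ψ(a)⟩ = 0`, where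
  `𝒰 = heatDuhamelBack ν` is the backward caloric Duhamel integral and `𝒰[∂ₜψ + νΔψ] = -ψ` is
  its backward heat equation (`HeatDuhamelBack`, `heatDuhamelBack_backward_heat`;
  `integral_integral_inner_heatTest_heatAdjointField_eq_zero`);
* the nonlinear term, after Fubini on `(a, b] × ((a, b] × E)` for a bounded field and an
  `L¹`-bounded kernel (`setIntegral_slab_duality_of_norm_le`, the `L^∞` twin of
  `setIntegral_slab_duality`) and `∫ K_t(τ, x) dt = D𝒰[Λ](τ)(x) = -Dψ(τ)(x)`, gives
  `-∫⟨u, (u·∇)ψ⟩ dτ`.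
Hence `∫ (⟨u, ∂ₜψ⟩ + ν⟨u, Δψ⟩) dt = -∫ ⟨u, (u·∇)ψ⟩ dt`, the weak identity. Joint measurability of
`u` makes the transport integrand measurable on the slab (no junk Bochner integrals); the `L^∞`
bound and the uniform `L¹` bounds of the caloric test fields make every Fubini step absolutely
convergent.

## Mathlib / tree search

Mathlib (this pin) has no heat semigroup on functions and no Navier–Stokes notions. From the
tree: the duality-form classes (`FluidPDE/MildSolution`, `SelfSimilar`), KNSS's bounded weak
class (`FluidPDE/KNSSLiouville`), the backward Duhamel integral with its backward heat equation
and derivative calculus (`FluidPDE/HeatDuhamelBack`), the transport kernel, its measurability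
and `∫ K_t dt = D𝒰` (`FluidPDE/KatoUniquenessDual`), the `L^∞`–`L¹` pairing lemmas
(`FluidPDE/AncientMildPairing`), `IsDivFree.fderiv_apply`, `divergence_eq_traceCLM`
(`TaoEnstrophyLocalisationProofs`). Used from Mathlib: `integrable_prod_iff`,
`integral_integral_swap`, `integral_prod`, `ContinuousOn.aestronglyMeasurable`,
`intervalIntegral.integral_comp_sub_right`, `setIntegral_eq_of_subset_of_forall_sdiff_eq_zero`,
`IsCompact.exists_isMaxOn`.

## References

* G. Koch, N. Nadirashvili, G. Seregin, V. Šverák, *Liouville theorems for the Navier–Stokes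
  equations and applications*, Acta Math. 203 (2009) 83–105 = arXiv:0709.3599, §4 (i)–(ii)
  p. 8 (mild and weak solutions in `L^∞`), §3 Lemma 3.1 p. 7. [KochNadirashviliSereginSverak2009]
* E. B. Fabes, B. F. Jones, N. M. Rivière, *The initial value problem for the Navier–Stokes
  equations with data in `L^p`*, Arch. Rational Mech. Anal. 45 (1972) 222–240, Thm. 2.1.
  [FabesJonesRiviere1972]
* P. G. Lemarié-Rieusset, *The Navier–Stokes problem in the 21st century*, CRC Press 2016,
  Prop. 4.3 (backward Duhamel integral) and proof of Thm. 7.7, fourth step (duality with `𝒰[Θ]`).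
  [LemarieRieusset2016]
-/

noncomputable section

open MeasureTheory Set Function Filter Topology TopologicalSpace InnerProductSpace
open scoped Laplacian RealInnerProductSpace NNReal ENNReal ContDiff

namespace Literature.Analysis.FluidPDE

variable {E : Type*} [NormedAddCommGroup E] [InnerProductSpace ℝ E] [FiniteDimensional ℝ E]
  [MeasurableSpace E] [BorelSpace E]

/-! ### Space–time test fields: time support on a slab, divergence-free closure -/

section TestFields

variable {F : Type*} [NormedAddCommGroup F] [NormedSpace ℝ F]

omit [MeasurableSpace E] [BorelSpace E] [FiniteDimensional ℝ E] [InnerProductSpace ℝ E] in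
/-- A space–time test field on the slab `(-∞, T) × E` has its time support in a compact interval
`[a, b]` with `b < T` (the projection of the compact support to the time axis is compact and
contained in `(-∞, T)`). [folklore] -/
theorem IsSpaceTimeTestOn.exists_time_support_lt [NormedSpace ℝ E] {T : ℝ} {ψ : ℝ → E → F}
    (hψ : IsSpaceTimeTestOn (slab E (Iio T) isOpen_Iio) ψ) :
    ∃ a b : ℝ, a ≤ b ∧ b < T ∧ ∀ t, t ∉ Icc a b → ψ t = 0 := by
  rcases (tsupport (uncurry ψ)).eq_empty_or_nonempty with h0 | hne
  · have hz : uncurry ψ = 0 := tsupport_eq_empty_iff.1 h0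
    refine ⟨T - 1, T - 1, le_rfl, by linarith, fun t _ => funext fun x => ?_⟩
    exact congrFun hz (t, x)
  · have hK : IsCompact (tsupport (uncurry ψ)) := hψ.hasCompactSupport
    obtain ⟨z₁, hz₁, hmax⟩ := hK.exists_isMaxOn hne continuous_fst.continuousOn
    obtain ⟨z₀, hz₀, hmin⟩ := hK.exists_isMinOn hne continuous_fst.continuousOn
    have hb : z₁.1 < T := by
      have h := hψ.tsupport_subset hz₁
      exact (mem_slab.1 h)
    refine ⟨z₀.1, z₁.1, hmin hz₁, hb, fun t ht => funext fun x => ?_⟩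
    by_contra hx
    have hmem : (t, x) ∈ tsupport (uncurry ψ) := subset_tsupport _ hx
    exact ht ⟨hmin hmem, hmax hmem⟩

omit [MeasurableSpace E] [BorelSpace E] in
/-- The Laplacian of a divergence-free `C³` vector field is divergence free
(`Δv = Σᵢ ∂ᵢ∂ᵢv` over an orthonormal frame, and `∂ᵢ` of a divergence-free field is divergence
free). [folklore] -/
theorem isDivFree_laplacian_of_contDiff {v : E → E} (hv : ContDiff ℝ 3 v)
    (hdiv : VectorCalculus.IsDivFree v) : VectorCalculus.IsDivFree (Δ v) := by
  set b := stdOrthonormalBasis ℝ E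
  have hv2 : ContDiff ℝ 2 v := hv.of_le (by norm_num)
  have hDi : ∀ w : E, ContDiff ℝ 2 (fun y => fderiv ℝ v y w) := fun w =>
    (hv.fderiv_right (m := 2) (by norm_num)).clm_apply contDiff_const
  have hDii : ∀ w : E, ContDiff ℝ 1 (fun y => fderiv ℝ (fun z => fderiv ℝ v z w) y w) := fun w =>
    ((hDi w).fderiv_right (m := 1) (by norm_num)).clm_apply contDiff_const
  have hΔ : Δ v = fun y => ∑ i, fderiv ℝ (fun z => fderiv ℝ v z (b i)) y (b i) :=
    funext fun y => laplacian_eq_sum_fderiv_fderiv_normed b hv2 y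
  have hdd : ∀ i, VectorCalculus.IsDivFree (fun y => fderiv ℝ (fun z => fderiv ℝ v z (b i)) y (b i)) :=
    fun i => VectorCalculus.IsDivFree.fderiv_apply (hDi (b i))
      (VectorCalculus.IsDivFree.fderiv_apply hv2 hdiv (b i)) (b i)
  intro x
  rw [hΔ, divergence_eq_traceCLM,
    fderiv_fun_sum fun i _ => ((hDii (b i)).differentiable one_ne_zero x), map_sum]
  exact Finset.sum_eq_zero fun i _ => hdd i x

omit [MeasurableSpace E] [BorelSpace E] in
/-- The time derivative of a space–time test field with divergence-free slices has
divergence-free slices: `div ∂ₜψ = ∂ₜ div ψ = 0`. [folklore] -/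
theorem IsSpaceTimeTestOn.isDivFree_timeDeriv {ψ : ℝ → E → E}
    (hψ : IsSpaceTimeTestOn (⊤ : Opens (ℝ × E)) ψ) (hdiv : ∀ t, VectorCalculus.IsDivFree (ψ t)) (t : ℝ) :
    VectorCalculus.IsDivFree (timeDeriv ψ t) := by
  intro x
  have hD : HasDerivAt (fun s => fderiv ℝ (ψ s) x) (fderiv ℝ (timeDeriv ψ t) x) t :=
    (hψ.isSmoothSpaceTimeOn univ).hasDerivAt_fderiv_slice_clm isOpen_univ (mem_univ t) x
  have htr : HasDerivAt (fun s => traceCLM (fderiv ℝ (ψ s) x))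
      (traceCLM (fderiv ℝ (timeDeriv ψ t) x)) t :=
    (traceCLM (E := E)).hasFDerivAt.comp_hasDerivAt t hD
  have hzero : HasDerivAt (fun s => traceCLM (fderiv ℝ (ψ s) x)) 0 t := by
    refine (hasDerivAt_const t (0 : ℝ)).congr_of_eventuallyEq (Eventually.of_forall fun s => ?_)
    have h := hdiv s x
    rw [divergence_eq_traceCLM] at h
    exact h
  rw [divergence_eq_traceCLM]
  exact htr.unique hzero

omit [MeasurableSpace E] [BorelSpace E] in
/-- The **adjoint heat operator applied to a space–time test field**, `Λ_ν ψ = ∂ₜψ + ν Δψ`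
(slicewise Laplacian), is a space–time test field on `ℝ × E`. Testing the duality (mild)
identity with the slices of `Λ_ν ψ` and integrating in time produces the space–time weak
formulation. [folklore] -/
theorem IsSpaceTimeTestOn.heatAdjointField_top {ψ : ℝ → E → F}
    (hψ : IsSpaceTimeTestOn (⊤ : Opens (ℝ × E)) ψ) (ν : ℝ) :
    IsSpaceTimeTestOn (⊤ : Opens (ℝ × E)) (fun t x => timeDeriv ψ t x + ν • Δ (ψ t) x) := by
  have h1 := hψ.timeDeriv_top
  have h2 := hψ.laplacian_top
  have heq : uncurry (fun t x => timeDeriv ψ t x + ν • Δ (ψ t) x) =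
      uncurry (timeDeriv ψ) + ν • uncurry (fun t => Δ (ψ t)) := by
    funext p
    rfl
  change FunctionSpaces.IsTestFunctionOn _ (uncurry (fun t x => timeDeriv ψ t x + ν • Δ (ψ t) x))
  rw [heq]
  exact ⟨h1.contDiff.add (contDiff_const.smul h2.contDiff),
    h1.hasCompactSupport.add h2.hasCompactSupport.smul_left, by simp⟩

omit [MeasurableSpace E] [BorelSpace E] in
/-- The slices of `Λ_ν ψ` are divergence free when the slices of `ψ` are. [folklore] -/
theorem IsSpaceTimeTestOn.isDivFree_heatAdjointField {ψ : ℝ → E → E}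
    (hψ : IsSpaceTimeTestOn (⊤ : Opens (ℝ × E)) ψ) (hdiv : ∀ t, VectorCalculus.IsDivFree (ψ t)) (ν t : ℝ) :
    VectorCalculus.IsDivFree (fun x => timeDeriv ψ t x + ν • Δ (ψ t) x) := by
  intro x
  have hd1 : DifferentiableAt ℝ (timeDeriv ψ t) x :=
    (hψ.timeDeriv_top.contDiff_slice t).differentiable (by simp) x
  have hΔ : ContDiff ℝ ∞ (Δ (ψ t)) := hψ.laplacian_top.contDiff_slice t
  have hd2 : DifferentiableAt ℝ (fun y => ν • Δ (ψ t) y) x :=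
    ((hΔ.differentiable (by simp)) x).const_smul ν
  have h := divergence_add_apply (v := timeDeriv ψ t) (w := fun y => ν • Δ (ψ t) y) (x := x) hd1 hd2
  have h3 := divergence_const_smul_apply (v := Δ (ψ t)) (x := x) ((hΔ.differentiable (by simp)) x) ν
  have h4 : VectorCalculus.divergence (Δ (ψ t)) x = 0 :=
    isDivFree_laplacian_of_contDiff (contDiff_infty.1 (hψ.contDiff_slice t) 3) (hdiv t) x
  have h5 : VectorCalculus.divergence (timeDeriv ψ t) x = 0 := hψ.isDivFree_timeDeriv hdiv t x
  rw [h3, h4, mul_zero, h5, add_zero] at h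
  exact h

omit [MeasurableSpace E] [BorelSpace E] in
/-- `Λ_ν ψ` inherits the time support of `ψ`. [folklore] -/
theorem heatAdjointField_eq_zero_of_time_support {ψ : ℝ → E → F} {a b : ℝ}
    (hab : ∀ t, t ∉ Icc a b → ψ t = 0) (ν : ℝ) {t : ℝ} (ht : t ∉ Icc a b) :
    (fun x => timeDeriv ψ t x + ν • Δ (ψ t) x) = 0 := by
  funext x
  have h1 : timeDeriv ψ t = 0 := timeDeriv_eq_zero_of_time_support hab ht
  have h2 : Δ (ψ t) x = 0 := by
    rw [hab t ht]
    exact congrFun (InnerProductSpace.laplacian_const (E := E) (c := (0 : F))) x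
  show timeDeriv ψ t x + ν • Δ (ψ t) x = 0
  rw [congrFun h1 x, h2, smul_zero, Pi.zero_apply, add_zero]

/-- **Backward heat equation for `Λ_ν ψ`**: the backward caloric Duhamel integral of
`Λ_ν ψ = ∂ₜψ + νΔψ` is `-ψ`, `𝒰[Λ_ν ψ](s) = -ψ(s)` (linearity of `𝒰` and
`heatDuhamelBack_backward_heat`). [folklore] -/
theorem IsSpaceTimeTestOn.heatDuhamelBack_heatAdjointField [CompleteSpace F] {ψ : ℝ → E → F}
    (hψ : IsSpaceTimeTestOn (⊤ : Opens (ℝ × E)) ψ) {ν : ℝ} (hν : 0 < ν) (s : ℝ) (x : E) :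
    heatDuhamelBack ν (fun t y => timeDeriv ψ t y + ν • Δ (ψ t) y) s x = -ψ s x := by
  have h1 := hψ.timeDeriv_top
  have h2 := hψ.laplacian_top
  have i1 := h1.integrableOn_duhamelIntegrand hν s x
  have i2' : IntegrableOn (fun σ => ν • UnboundedOperators.heatExtension (Δ (ψ (s + σ))) (ν * σ) x)
      (Ioi 0) volume := (h2.integrableOn_duhamelIntegrand hν s x).smul ν
  rw [← hψ.heatDuhamelBack_backward_heat hν s x, heatDuhamelBack_apply, heatDuhamelBack_apply,
    heatDuhamelBack_apply, ← integral_smul, ← integral_add i1 i2']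
  refine setIntegral_congr_fun measurableSet_Ioi fun σ _ => ?_
  -- pointwise linearity of the caloric extension on test data
  have iA := UnboundedOperators.integrable_heatKernel_smul_comp_sub ((h1.contDiff_slice (s + σ)).continuous)
    (h1.hasCompactSupport_slice (s + σ)) (ν * σ) x
  have iB := UnboundedOperators.integrable_heatKernel_smul_comp_sub ((h2.contDiff_slice (s + σ)).continuous)
    (h2.hasCompactSupport_slice (s + σ)) (ν * σ) x
  have iB' : Integrable (fun y => ν • (UnboundedOperators.heatKernel (ν * σ) y • Δ (ψ (s + σ)) (x - y)))
      volume := iB.smul ν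
  simp only [UnboundedOperators.heatExtension_apply]
  simp_rw [smul_add, smul_comm (UnboundedOperators.heatKernel (ν * σ) _) ν]
  rw [integral_add iA iB', integral_smul]

end TestFields

/-! ### `L¹` bounds for the transport kernel of a space–time test field -/

section Kernel

variable {ν : ℝ} {Θ : ℝ → E → E}

/-- **Uniform `L¹` bound of the transport kernel slices**: the kernel
`x ↦ 1_{τ<t} D(e^{ν(t-τ)Δ}Θ(t))(x)` is integrable with `∫ ‖·‖ ≤ sup_t ‖DΘ(t)‖_{L¹}` (the derivative
falls on the data, `fderiv_heatTest_of_pos`, and `e^{σΔ}` contracts `L¹`). [folklore] -/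
theorem IsSpaceTimeTestOn.exists_integral_norm_transportKernel_le
    (hΘ : IsSpaceTimeTestOn (⊤ : Opens (ℝ × E)) Θ) (hν : 0 < ν) :
    ∃ R : ℝ, 0 ≤ R ∧ ∀ t τ : ℝ,
      Integrable (fun x => (if τ < t then fderiv ℝ (heatTest ν (Θ t) (t - τ)) x else 0)) volume ∧
      ∫ x, ‖(if τ < t then fderiv ℝ (heatTest ν (Θ t) (t - τ)) x else 0)‖ ≤ R := by
  obtain ⟨M₁, hM₁0, hM₁⟩ := hΘ.fderiv_top.exists_integral_norm_slice_le
  refine ⟨M₁, hM₁0, fun t τ => ?_⟩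
  by_cases h : τ < t
  · simp only [if_pos h]
    have hφ1 : ContDiff ℝ 1 (Θ t) := contDiff_infty.1 (hΘ.contDiff_slice t) 1
    have hφc := hΘ.hasCompactSupport_slice t
    have heq : ∀ x, fderiv ℝ (heatTest ν (Θ t) (t - τ)) x =
        UnboundedOperators.heatExtension (fderiv ℝ (Θ t)) (ν * (t - τ)) x :=
      fun x => fderiv_heatTest_of_pos hν (sub_pos.2 h) hφ1 hφc x
    simp_rw [heq]
    have hc : Continuous (fderiv ℝ (Θ t)) := hφ1.continuous_fderiv one_ne_zero
    obtain ⟨hi, hle⟩ := integral_norm_heatExtension_le hc (hφc.fderiv ℝ) (mul_pos hν (sub_pos.2 h))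
    exact ⟨hi, hle.trans (hM₁ t)⟩
  · simp only [if_neg h]
    refine ⟨integrable_zero _ _ _, ?_⟩
    simp [hM₁0]

end Kernel

/-! ### Fubini bookkeeping on a slab for a bounded field and an `L¹` transport kernel -/

section SlabFubini

variable {K : ℝ → ℝ × E → E →L[ℝ] E} {a : ℝ → E → E} {τ₀ τ₁ : ℝ} {M R : ℝ}

/-- **`x`-integrability of the transport integrand** `⟪w, Ψ w⟫` for a bounded measurable field
`w` (`‖w‖ ≤ M`) and an integrable operator field `Ψ`, with `∫ |⟪w, Ψ w⟫| ≤ M² ‖Ψ‖_{L¹}`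
(the `L^∞`–`L¹`–`L^∞` pairing). [folklore] -/
theorem integrable_inner_clm_apply_of_norm_le {w : E → E} {Ψ : E → E →L[ℝ] E}
    (hw : AEStronglyMeasurable w volume) {M : ℝ} (hM : ∀ x, ‖w x‖ ≤ M) (hΨ : Integrable Ψ volume) :
    Integrable (fun x => ⟪w x, Ψ x (w x)⟫) volume ∧
      ∫ x, ‖⟪w x, Ψ x (w x)⟫‖ ≤ M ^ 2 * ∫ x, ‖Ψ x‖ := by
  have hM0 : 0 ≤ M := (norm_nonneg _).trans (hM 0)
  have happ := (isBoundedBilinearMap_apply (𝕜 := ℝ) (E := E) (F := E)).continuous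
  have hmeas : AEStronglyMeasurable (fun x => ⟪w x, Ψ x (w x)⟫) volume :=
    hw.inner (happ.comp_aestronglyMeasurable (hΨ.aestronglyMeasurable.prodMk hw))
  have hle : ∀ x, ‖⟪w x, Ψ x (w x)⟫‖ ≤ M ^ 2 * ‖Ψ x‖ := fun x =>
    calc ‖⟪w x, Ψ x (w x)⟫‖ ≤ ‖w x‖ * ‖Ψ x (w x)‖ := norm_inner_le_norm _ _
      _ ≤ ‖w x‖ * (‖Ψ x‖ * ‖w x‖) :=
        mul_le_mul_of_nonneg_left (ContinuousLinearMap.le_opNorm _ _) (norm_nonneg _)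
      _ ≤ M * (‖Ψ x‖ * M) :=
        mul_le_mul (hM x) (mul_le_mul_of_nonneg_left (hM x) (norm_nonneg _)) (by positivity) hM0
      _ = M ^ 2 * ‖Ψ x‖ := by ring
  have hint : Integrable (fun x => ⟪w x, Ψ x (w x)⟫) volume :=
    Integrable.mono' (hΨ.norm.const_mul (M ^ 2)) hmeas (Eventually.of_forall hle)
  refine ⟨hint, ?_⟩
  calc ∫ x, ‖⟪w x, Ψ x (w x)⟫‖ ≤ ∫ x, M ^ 2 * ‖Ψ x‖ :=
        integral_mono hint.norm (hΨ.norm.const_mul _) hle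
    _ = M ^ 2 * ∫ x, ‖Ψ x‖ := integral_const_mul _ _

/-- **Integrability of a time slice of the transport integrand on the slab** `(τ₀, τ₁] × E`
for a bounded jointly measurable field, with `L¹` bound `M² R (τ₁ - τ₀)`. [folklore] -/
theorem integrable_transportIntegrand_slab_of_norm_le (hτ : τ₀ ≤ τ₁)
    (hK1 : ∀ t τ, Integrable (fun x => K t (τ, x)) volume ∧ ∫ x, ‖K t (τ, x)‖ ≤ R) {t : ℝ}
    (hKt : AEStronglyMeasurable (K t) ((volume.restrict (Ioc τ₀ τ₁)).prod (volume : Measure E)))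
    (ha : AEStronglyMeasurable (uncurry a) ((volume.restrict (Ioc τ₀ τ₁)).prod (volume : Measure E)))
    (haτ : ∀ τ ∈ Icc τ₀ τ₁, AEStronglyMeasurable (a τ) volume)
    (haM : ∀ τ ∈ Icc τ₀ τ₁, ∀ x, ‖a τ x‖ ≤ M) :
    Integrable (fun y : ℝ × E => ⟪a y.1 y.2, K t y (a y.1 y.2)⟫)
        ((volume.restrict (Ioc τ₀ τ₁)).prod (volume : Measure E)) ∧
      ∫ y, ‖⟪a y.1 y.2, K t y (a y.1 y.2)⟫‖ ∂((volume.restrict (Ioc τ₀ τ₁)).prod (volume : Measure E)) ≤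
        M ^ 2 * R * (τ₁ - τ₀) := by
  haveI : IsFiniteMeasure (volume.restrict (Ioc τ₀ τ₁)) :=
    isFiniteMeasure_restrict.2 measure_Ioc_lt_top.ne
  have happ := (isBoundedBilinearMap_apply (𝕜 := ℝ) (E := E) (F := E)).continuous
  have hmeas : AEStronglyMeasurable (fun y : ℝ × E => ⟪a y.1 y.2, K t y (a y.1 y.2)⟫)
      ((volume.restrict (Ioc τ₀ τ₁)).prod (volume : Measure E)) :=
    ha.inner (happ.comp_aestronglyMeasurable (hKt.prodMk ha))
  have hsl : ∀ τ ∈ Icc τ₀ τ₁,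
      Integrable (fun x => ⟪a τ x, K t (τ, x) (a τ x)⟫) volume ∧
        ∫ x, ‖⟪a τ x, K t (τ, x) (a τ x)⟫‖ ≤ M ^ 2 * R := fun τ hτ' => by
    obtain ⟨hi, hle⟩ := integrable_inner_clm_apply_of_norm_le (haτ τ hτ') (haM τ hτ') (hK1 t τ).1
    exact ⟨hi, hle.trans (mul_le_mul_of_nonneg_left (hK1 t τ).2 (sq_nonneg M))⟩
  have hint : Integrable (fun y : ℝ × E => ⟪a y.1 y.2, K t y (a y.1 y.2)⟫)
      ((volume.restrict (Ioc τ₀ τ₁)).prod (volume : Measure E)) := by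
    rw [integrable_prod_iff hmeas]
    constructor
    · refine (ae_restrict_iff' measurableSet_Ioc).2 (Eventually.of_forall fun τ hτ' => ?_)
      exact (hsl τ (Ioc_subset_Icc_self hτ')).1
    · refine Integrable.mono' (integrable_const (M ^ 2 * R)) hmeas.norm.integral_prod_right' ?_
      refine (ae_restrict_iff' measurableSet_Ioc).2 (Eventually.of_forall fun τ hτ' => ?_)
      rw [Real.norm_of_nonneg (integral_nonneg fun _ => norm_nonneg _)]
      exact (hsl τ (Ioc_subset_Icc_self hτ')).2
  refine ⟨hint, ?_⟩
  rw [integral_prod _ hint.norm]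
  calc ∫ τ in Ioc τ₀ τ₁, ∫ x, ‖⟪a τ x, K t (τ, x) (a τ x)⟫‖
      ≤ ∫ τ in Ioc τ₀ τ₁, M ^ 2 * R := by
        refine setIntegral_mono_on hint.norm.integral_prod_left
          (integrableOn_const measure_Ioc_lt_top.ne) measurableSet_Ioc fun τ hτ' => ?_
        exact (hsl τ (Ioc_subset_Icc_self hτ')).2
    _ = M ^ 2 * R * (τ₁ - τ₀) := by
        rw [setIntegral_const, Real.volume_real_Ioc_of_le hτ, smul_eq_mul]; ring

/-- **Integrability of the transport integrand on `(τ₀, τ₁] × ((τ₀, τ₁] × E)`** for a bounded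
jointly measurable field. [folklore] -/
theorem integrable_transportIntegrand_of_norm_le (hτ : τ₀ ≤ τ₁)
    (hK1 : ∀ t τ, Integrable (fun x => K t (τ, x)) volume ∧ ∫ x, ‖K t (τ, x)‖ ≤ R)
    (hK : AEStronglyMeasurable (uncurry K) ((volume.restrict (Ioc τ₀ τ₁)).prod
      ((volume.restrict (Ioc τ₀ τ₁)).prod (volume : Measure E))))
    (hKt : ∀ t, AEStronglyMeasurable (K t) ((volume.restrict (Ioc τ₀ τ₁)).prod (volume : Measure E)))
    (ha : AEStronglyMeasurable (uncurry a) ((volume.restrict (Ioc τ₀ τ₁)).prod (volume : Measure E)))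
    (haτ : ∀ τ ∈ Icc τ₀ τ₁, AEStronglyMeasurable (a τ) volume)
    (haM : ∀ τ ∈ Icc τ₀ τ₁, ∀ x, ‖a τ x‖ ≤ M) :
    Integrable (fun q : ℝ × (ℝ × E) => ⟪a q.2.1 q.2.2, K q.1 q.2 (a q.2.1 q.2.2)⟫)
      ((volume.restrict (Ioc τ₀ τ₁)).prod
        ((volume.restrict (Ioc τ₀ τ₁)).prod (volume : Measure E))) := by
  haveI : IsFiniteMeasure (volume.restrict (Ioc τ₀ τ₁)) :=
    isFiniteMeasure_restrict.2 measure_Ioc_lt_top.ne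
  have happ := (isBoundedBilinearMap_apply (𝕜 := ℝ) (E := E) (F := E)).continuous
  have ha' : AEStronglyMeasurable (fun q : ℝ × (ℝ × E) => uncurry a q.2)
      ((volume.restrict (Ioc τ₀ τ₁)).prod ((volume.restrict (Ioc τ₀ τ₁)).prod (volume : Measure E))) :=
    ha.comp_snd
  have hmeas : AEStronglyMeasurable
      (fun q : ℝ × (ℝ × E) => ⟪a q.2.1 q.2.2, K q.1 q.2 (a q.2.1 q.2.2)⟫)
      ((volume.restrict (Ioc τ₀ τ₁)).prod ((volume.restrict (Ioc τ₀ τ₁)).prod (volume : Measure E))) :=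
    ha'.inner (happ.comp_aestronglyMeasurable (hK.prodMk ha'))
  have hsl := fun t => integrable_transportIntegrand_slab_of_norm_le hτ hK1 (hKt t) ha haτ haM
  rw [integrable_prod_iff hmeas]
  refine ⟨Eventually.of_forall fun t => (hsl t).1, ?_⟩
  refine Integrable.mono' (integrable_const (M ^ 2 * R * (τ₁ - τ₀)))
    hmeas.norm.integral_prod_right' (Eventually.of_forall fun t => ?_)
  rw [Real.norm_of_nonneg (integral_nonneg fun _ => norm_nonneg _)]
  exact (hsl t).2

/-- **Abstract slab duality for a bounded field.** Let `K` be a transport kernel on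
`(τ₀, τ₁] × ((τ₀, τ₁] × E)` with uniformly `L¹`-bounded, measurable slices, `a` a jointly
measurable field bounded by `M`, and suppose: (i) for every `t ∈ (τ₀, τ₁]` the quantity `Φ(t)`
equals the slab integral of the transport integrand `⟪a, K_t a⟫`; (ii) for every `(τ, x)` with
`τ ∈ (τ₀, τ₁]`, `t ↦ K_t(τ, x)` is integrable on `(τ₀, τ₁]` with integral `D(τ)(x)`. Then
`∫_{(τ₀,τ₁]} Φ(t) dt = ∫_{(τ₀,τ₁]} ∫ ⟪a, D a⟫ dτ` (Fubini on the slab twice, the time integral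
moved inside the continuous bilinear pairing; the `L^∞` twin of `setIntegral_slab_duality`). [folklore] -/
theorem setIntegral_slab_duality_of_norm_le (hτ : τ₀ ≤ τ₁)
    (hK1 : ∀ t τ, Integrable (fun x => K t (τ, x)) volume ∧ ∫ x, ‖K t (τ, x)‖ ≤ R)
    (hK : AEStronglyMeasurable (uncurry K) ((volume.restrict (Ioc τ₀ τ₁)).prod
      ((volume.restrict (Ioc τ₀ τ₁)).prod (volume : Measure E))))
    (hKt : ∀ t, AEStronglyMeasurable (K t) ((volume.restrict (Ioc τ₀ τ₁)).prod (volume : Measure E)))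
    (ha : AEStronglyMeasurable (uncurry a) ((volume.restrict (Ioc τ₀ τ₁)).prod (volume : Measure E)))
    (haτ : ∀ τ ∈ Icc τ₀ τ₁, AEStronglyMeasurable (a τ) volume)
    (haM : ∀ τ ∈ Icc τ₀ τ₁, ∀ x, ‖a τ x‖ ≤ M)
    {Φ : ℝ → ℝ} {D : ℝ → E → E →L[ℝ] E}
    (hslice : ∀ t ∈ Ioc τ₀ τ₁, Φ t =
      ∫ y, ⟪a y.1 y.2, K t y (a y.1 y.2)⟫ ∂((volume.restrict (Ioc τ₀ τ₁)).prod (volume : Measure E)))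
    (hKint : ∀ y : ℝ × E, y.1 ∈ Ioc τ₀ τ₁ →
      IntegrableOn (fun t => K t y) (Ioc τ₀ τ₁) volume ∧ ∫ t in Ioc τ₀ τ₁, K t y = D y.1 y.2) :
    ∫ t in Ioc τ₀ τ₁, Φ t = ∫ τ in Ioc τ₀ τ₁, ∫ x, ⟪a τ x, D τ x (a τ x)⟫ := by
  have hJ := integrable_transportIntegrand_of_norm_le hτ hK1 hK hKt ha haτ haM
  have hJ' : Integrable (uncurry fun (t : ℝ) (y : ℝ × E) => ⟪a y.1 y.2, K t y (a y.1 y.2)⟫)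
      ((volume.restrict (Ioc τ₀ τ₁)).prod
        ((volume.restrict (Ioc τ₀ τ₁)).prod (volume : Measure E))) := hJ
  rw [setIntegral_congr_fun measurableSet_Ioc hslice, integral_integral_swap hJ']
  -- the time integral moves inside the pairing, for a.e. `y`
  have hI : ∀ᵐ y ∂((volume.restrict (Ioc τ₀ τ₁)).prod (volume : Measure E)), y.1 ∈ Ioc τ₀ τ₁ :=
    (Measure.quasiMeasurePreserving_fst (μ := volume.restrict (Ioc τ₀ τ₁))
      (ν := (volume : Measure E))).ae
      (ae_restrict_mem measurableSet_Ioc)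
  have e3 : ∀ᵐ y ∂((volume.restrict (Ioc τ₀ τ₁)).prod (volume : Measure E)),
      ∫ t in Ioc τ₀ τ₁, ⟪a y.1 y.2, K t y (a y.1 y.2)⟫ = ⟪a y.1 y.2, D y.1 y.2 (a y.1 y.2)⟫ := by
    filter_upwards [hI] with y hy
    obtain ⟨hKi, hKD⟩ := hKint y hy
    rw [integral_inner (hKi.apply_continuousLinearMap _), ← ContinuousLinearMap.integral_apply hKi, hKD]
  rw [integral_congr_ae e3]
  have hL : Integrable (fun y : ℝ × E => ⟪a y.1 y.2, D y.1 y.2 (a y.1 y.2)⟫)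
      ((volume.restrict (Ioc τ₀ τ₁)).prod (volume : Measure E)) :=
    hJ.integral_prod_right.congr e3
  rw [integral_prod _ hL]

end SlabFubini

/-! ### Mild ⇒ weak for bounded, jointly measurable ancient solutions -/

section Main

variable {ν : ℝ} {u : ℝ → E → E}

/-- Joint measurability on a sub-slab `(a, b] × E ⊆ (-∞, 0) × E`. [folklore] -/
theorem aestronglyMeasurable_uncurry_restrict_Ioc_of_Iio {a b : ℝ} (hb : b < 0)
    (hmeas : AEStronglyMeasurable (uncurry u) ((volume : Measure (ℝ × E)).restrict (Iio 0 ×ˢ univ))) :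
    AEStronglyMeasurable (uncurry u) ((volume.restrict (Ioc a b)).prod (volume : Measure E)) := by
  rw [← volume_restrict_prod_univ_eq_prod]
  refine hmeas.mono_measure (Measure.restrict_mono (Set.prod_mono (fun τ hτ => ?_) le_rfl) le_rfl)
  exact hτ.2.trans_lt hb

/-- **The tested two-time identity as a slab integral.** For an ancient mild solution `u`
(duality form, `0 < ν`) bounded by `M` with measurable slices and jointly measurable on
`(a, b] × E`, `a ≤ b < 0`, a space–time test field `Θ` with divergence-free slices, and
`t ∈ (a, b]`: `∫⟪u(t), Θ(t)⟫ - ∫⟪u(a), e^{ν(t-a)Δ}Θ(t)⟫` equals the integral over the slab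
`(a, b] × E` of the transport integrand `⟪u, K_t u⟫`, `K_t(τ, x) = 1_{τ<t} D(e^{ν(t-τ)Δ}Θ(t))(x)`
(the two-time identity between `a` and `t` with the test `Θ(t)`, Fubini on the slab). [folklore] -/
theorem IsAncientMildSolution.integral_inner_sub_eq_slab (hu : IsAncientMildSolution ν u) (hν : 0 < ν)
    {M : ℝ} (hM : ∀ t < 0, ∀ x, ‖u t x‖ ≤ M) (hsl : ∀ t < 0, AEStronglyMeasurable (u t) volume)
    {a b : ℝ} (hab : a ≤ b) (hb : b < 0)
    (hmeas : AEStronglyMeasurable (uncurry u) ((volume.restrict (Ioc a b)).prod (volume : Measure E)))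
    {Θ : ℝ → E → E} (hΘ : IsSpaceTimeTestOn (⊤ : Opens (ℝ × E)) Θ)
    (hΘd : ∀ t, VectorCalculus.IsDivFree (Θ t)) {t : ℝ} (ht : t ∈ Ioc a b) :
    (∫ x, ⟪u t x, Θ t x⟫) - ∫ x, ⟪u a x, heatTest ν (Θ t) (t - a) x⟫ =
      ∫ y, ⟪u y.1 y.2, (if y.1 < t then fderiv ℝ (heatTest ν (Θ t) (t - y.1)) y.2 else 0) (u y.1 y.2)⟫
        ∂((volume.restrict (Ioc a b)).prod (volume : Measure E)) := by
  have ht0 : t < 0 := ht.2.trans_lt hb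
  have key := hu.2 a t ht.1 ht0 (Θ t) (hΘ.isTestFunctionOn_slice t) (hΘd t)
  have hzero : (∫ τ in a..t, ∫ x, ⟪(0 : ℝ → E → E) τ x, heatTest ν (Θ t) (t - τ) x⟫) = 0 := by simp
  rw [hzero, add_zero] at key
  rw [key, add_sub_cancel_left, intervalIntegral.integral_of_le ht.1.le]
  -- the slab integral, by Fubini
  obtain ⟨R, -, hK1⟩ := hΘ.exists_integral_norm_transportKernel_le hν
  have haτ : ∀ τ ∈ Icc a b, AEStronglyMeasurable (u τ) volume := fun τ hτ => hsl τ (hτ.2.trans_lt hb)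
  have haM : ∀ τ ∈ Icc a b, ∀ x, ‖u τ x‖ ≤ M := fun τ hτ => hM τ (hτ.2.trans_lt hb)
  have hslab := integrable_transportIntegrand_slab_of_norm_le (a := u)
    (K := fun (t' : ℝ) (y : ℝ × E) => if y.1 < t' then fderiv ℝ (heatTest ν (Θ t') (t' - y.1)) y.2 else 0)
    (t := t) hab hK1 (hΘ.aestronglyMeasurable_transportKernel_slice hν t _) hmeas haτ haM
  rw [integral_prod _ hslab.1]
  dsimp only
  -- restrict the time integral on the right to `(a, t]`
  have hvan : ∀ τ, ¬ τ < t → (∫ x, ⟪u τ x,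
      (if τ < t then fderiv ℝ (heatTest ν (Θ t) (t - τ)) x else 0) (u τ x)⟫) = 0 := by
    intro τ hτt
    simp [if_neg hτt]
  have e2 : (∫ τ in Ioc a b, ∫ x, ⟪u τ x,
      (if τ < t then fderiv ℝ (heatTest ν (Θ t) (t - τ)) x else 0) (u τ x)⟫) =
      ∫ τ in Ioc a t, ∫ x, ⟪u τ x,
        (if τ < t then fderiv ℝ (heatTest ν (Θ t) (t - τ)) x else 0) (u τ x)⟫ := by
    have hind : EqOn (fun τ => ∫ x, ⟪u τ x,
        (if τ < t then fderiv ℝ (heatTest ν (Θ t) (t - τ)) x else 0) (u τ x)⟫)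
        ((Iic t).indicator fun τ => ∫ x, ⟪u τ x,
          (if τ < t then fderiv ℝ (heatTest ν (Θ t) (t - τ)) x else 0) (u τ x)⟫)
        (Ioc a b) := fun τ _ => by
      by_cases h : τ ≤ t
      · rw [indicator_of_mem (show τ ∈ Iic t from h)]
      · rw [indicator_of_notMem (show τ ∉ Iic t from h)]
        exact hvan τ fun hlt => h hlt.le
    rw [setIntegral_congr_fun measurableSet_Ioc hind, setIntegral_indicator measurableSet_Iic,
      Ioc_inter_Iic, inf_of_le_right ht.2]
  rw [e2]
  refine setIntegral_congr_ae measurableSet_Ioc ?_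
  filter_upwards [measure_eq_zero_iff_ae_notMem.1 (measure_singleton t)] with τ hτt hτ'
  have hlt : τ < t := lt_of_le_of_ne hτ'.2 hτt
  simp only [if_pos hlt, convect_apply]

/-- **The free (caloric) term integrates to zero in time.** For a bounded measurable field `w`,
a space–time test field `ψ` with time support in `[a', b']`, and `a < a'`, `b' ≤ b`:
`∫_{(a,b]} ⟨w, e^{ν(t-a)Δ} Λ_ν ψ(t)⟩ dt = ⟨w, 𝒰[Λ_ν ψ](a)⟩ = -⟨w, ψ(a)⟩ = 0`
(Fubini, the substitution `t = a + σ`, and the backward heat equation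
`𝒰[∂ₜψ + νΔψ] = -ψ`, `heatDuhamelBack_backward_heat`). [folklore] -/
theorem integral_integral_inner_heatTest_heatAdjointField_eq_zero (hν : 0 < ν)
    {w : E → E} (hw : AEStronglyMeasurable w volume) {M : ℝ} (hM : ∀ x, ‖w x‖ ≤ M)
    {ψ : ℝ → E → E} (hψ : IsSpaceTimeTestOn (⊤ : Opens (ℝ × E)) ψ)
    {a' b' a b : ℝ} (hsupp : ∀ t, t ∉ Icc a' b' → ψ t = 0) (haa' : a < a') (hab : a ≤ b)
    (hb'b : b' ≤ b) :
    ∫ t in Ioc a b, ∫ x, ⟪w x, heatTest ν (fun y => timeDeriv ψ t y + ν • Δ (ψ t) y) (t - a) x⟫ = 0 := by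
  set Λ : ℝ → E → E := fun t y => timeDeriv ψ t y + ν • Δ (ψ t) y with hΛ_def
  have hΛ : IsSpaceTimeTestOn (⊤ : Opens (ℝ × E)) Λ := hψ.heatAdjointField_top ν
  have hΛsupp : ∀ t, t ∉ Icc a' b' → Λ t = 0 := fun t ht =>
    heatAdjointField_eq_zero_of_time_support hsupp ν ht
  have hψa : ψ a = 0 := hsupp a fun h => by linarith [h.1]
  have hM0 : 0 ≤ M := (norm_nonneg _).trans (hM 0)
  obtain ⟨C, -, hC⟩ := hΛ.exists_norm_le
  obtain ⟨M₁, -, hM₁⟩ := hΛ.exists_integral_norm_slice_le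
  -- the heat part `G(t, x) = e^{ν(t-a)Δ} Λ(t)(x)` written with the caloric extension
  set G : ℝ × E → E := fun q =>
    UnboundedOperators.heatExtension (Λ (a + (q.1 - a))) (ν * (q.1 - a)) q.2 with hG_def
  have hH : ∀ t, a < t → ∀ x, heatTest ν (Λ t) (t - a) x = G (t, x) := by
    intro t ht x
    simp only [hG_def, add_sub_cancel]
    rw [heatTest_of_pos hν (sub_pos.2 ht)]
  have hcont : ContinuousOn G {q : ℝ × E | a < q.1} := by
    have hc2 : Continuous fun q : ℝ × E => ((a, q.1 - a, q.2) : ℝ × ℝ × E) := by fun_prop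
    have h := ContinuousOn.comp (g := fun p : ℝ × ℝ × E =>
        UnboundedOperators.heatExtension (Λ (p.1 + p.2.1)) (ν * p.2.1) p.2.2)
      (f := fun q : ℝ × E => ((a, q.1 - a, q.2) : ℝ × ℝ × E)) (s := {q : ℝ × E | a < q.1})
      (hΛ.continuousOn_duhamelIntegrand hν) hc2.continuousOn
      (fun q hq => show (0 : ℝ) < q.1 - a from sub_pos.2 hq)
    simpa only [Function.comp_def] using h
  -- integrability of the `x`-slices of `G` with the uniform `L¹` bound
  have hGint : ∀ t, a < t → Integrable (fun x => G (t, x)) volume ∧ ∫ x, ‖G (t, x)‖ ≤ M₁ := by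
    intro t ht
    obtain ⟨hi, hle⟩ := integral_norm_heatExtension_le ((hΛ.contDiff_slice _).continuous)
      (hΛ.hasCompactSupport_slice (a + (t - a))) (mul_pos hν (sub_pos.2 ht))
    exact ⟨hi, hle.trans (hM₁ _)⟩
  -- the pairing `F(t, x) = ⟪w x, G(t, x)⟫` is integrable on the slab `(a, b] × E`
  set μ : Measure ℝ := volume.restrict (Ioc a b) with hμ
  haveI : IsFiniteMeasure μ := by rw [hμ]; exact isFiniteMeasure_restrict.2 measure_Ioc_lt_top.ne
  have hGm : AEStronglyMeasurable G (μ.prod (volume : Measure E)) := by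
    have hS : MeasurableSet {q : ℝ × E | a < q.1} := measurableSet_lt measurable_const measurable_fst
    have h1 : AEStronglyMeasurable G ((volume : Measure (ℝ × E)).restrict {q : ℝ × E | a < q.1}) :=
      hcont.aestronglyMeasurable hS
    rw [hμ, ← volume_restrict_prod_univ_eq_prod]
    refine h1.mono_measure (Measure.restrict_mono (fun q hq => ?_) le_rfl)
    exact (mem_prod.1 hq).1.1
  have hFm : AEStronglyMeasurable (fun q : ℝ × E => ⟪w q.2, G q⟫) (μ.prod (volume : Measure E)) :=
    (hw.comp_snd).inner hGm
  have hF : Integrable (fun q : ℝ × E => ⟪w q.2, G q⟫) (μ.prod (volume : Measure E)) := by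
    rw [integrable_prod_iff hFm]
    constructor
    · rw [hμ]
      refine (ae_restrict_iff' measurableSet_Ioc).2 (Eventually.of_forall fun t ht => ?_)
      exact integrable_inner_of_aestronglyMeasurable_of_norm_le hw hM (hGint t ht.1).1
    · refine Integrable.mono' (integrable_const (M * M₁)) hFm.norm.integral_prod_right' ?_
      rw [hμ]
      refine (ae_restrict_iff' measurableSet_Ioc).2 (Eventually.of_forall fun t ht => ?_)
      rw [Real.norm_of_nonneg (integral_nonneg fun _ => norm_nonneg _)]
      obtain ⟨hi, hle⟩ := hGint t ht.1
      calc ∫ x, ‖⟪w x, G (t, x)⟫‖ ≤ ∫ x, M * ‖G (t, x)‖ := by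
            refine integral_mono_of_nonneg (Eventually.of_forall fun _ => norm_nonneg _)
              (hi.norm.const_mul M) (Eventually.of_forall fun x => ?_)
            exact (norm_inner_le_norm _ _).trans (mul_le_mul_of_nonneg_right (hM x) (norm_nonneg _))
        _ = M * ∫ x, ‖G (t, x)‖ := integral_const_mul _ _
        _ ≤ M * M₁ := mul_le_mul_of_nonneg_left hle hM0
  -- replace `heatTest` by `G` and swap the integrals
  have e1 : ∫ t in Ioc a b, ∫ x, ⟪w x, heatTest ν (Λ t) (t - a) x⟫ = ∫ t in Ioc a b, ∫ x, ⟪w x, G (t, x)⟫ := by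
    refine setIntegral_congr_fun measurableSet_Ioc fun t ht => ?_
    refine integral_congr_ae (Eventually.of_forall fun x => ?_)
    show ⟪w x, heatTest ν (Λ t) (t - a) x⟫ = ⟪w x, G (t, x)⟫
    rw [hH t ht.1 x]
  rw [e1]
  have hF' : Integrable (uncurry fun (t : ℝ) (x : E) => ⟪w x, G (t, x)⟫) (μ.prod (volume : Measure E)) := hF
  rw [integral_integral_swap hF']
  -- the time integral of `G(·, x)` is `𝒰[Λ](a)(x) = -ψ(a)(x) = 0`
  have hGt : ∀ x, IntegrableOn (fun t => G (t, x)) (Ioc a b) volume ∧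
      ∫ t in Ioc a b, G (t, x) = heatDuhamelBack ν Λ a x := by
    intro x
    have hS : MeasurableSet (Ioi a) := measurableSet_Ioi
    have hc2 : Continuous fun t : ℝ => ((t, x) : ℝ × E) := by fun_prop
    have hct : ContinuousOn (fun t => G (t, x)) (Ioi a) := by
      have h := ContinuousOn.comp (s := Ioi a) hcont hc2.continuousOn
        (fun t (ht : t ∈ Ioi a) => show ((t, x) : ℝ × E) ∈ {q : ℝ × E | a < q.1} from ht)
      simpa only [Function.comp_def] using h
    have hmt : AEStronglyMeasurable (fun t => G (t, x)) (volume.restrict (Ioc a b)) :=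
      (hct.aestronglyMeasurable hS).mono_measure (Measure.restrict_mono Ioc_subset_Ioi_self le_rfl)
    have hint : IntegrableOn (fun t => G (t, x)) (Ioc a b) volume := by
      refine Integrable.mono' (integrable_const C) hmt ?_
      refine (ae_restrict_iff' measurableSet_Ioc).2 (Eventually.of_forall fun t ht => ?_)
      exact UnboundedOperators.norm_heatExtension_le (hC _) (mul_pos hν (sub_pos.2 ht.1)) x
    refine ⟨hint, ?_⟩
    rw [hΛ.heatDuhamelBack_eq_setIntegral_Ioc hν hΛsupp (s := a) (L := b - a) (sub_nonneg.2 hab)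
      (by linarith) x, ← intervalIntegral.integral_of_le hab,
      ← intervalIntegral.integral_of_le (sub_nonneg.2 hab)]
    have h := intervalIntegral.integral_comp_sub_right (a := a) (b := b)
      (fun σ => UnboundedOperators.heatExtension (Λ (a + σ)) (ν * σ) x) a
    rw [sub_self] at h
    rw [← h]
  have e3 : ∀ x, ∫ t in Ioc a b, ⟪w x, G (t, x)⟫ = 0 := fun x => by
    obtain ⟨hint, hval⟩ := hGt x
    rw [integral_inner hint, hval]
    have h0 : heatDuhamelBack ν Λ a x = 0 := by
      rw [hΛ_def, hψ.heatDuhamelBack_heatAdjointField hν a x, hψa]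
      simp
    rw [h0, inner_zero_right]
  simp_rw [hμ] at e3 ⊢
  simp [e3]

/-- **Slab integrability of the pairing of a bounded jointly measurable field with a space–time
test field** `(t, x) ↦ ⟪u t x, Θ t x⟫` on `(a, b] × E`. [folklore] -/
theorem integrable_prod_inner_test_of_norm_le {a b : ℝ} {M : ℝ}
    (hmeas : AEStronglyMeasurable (uncurry u) ((volume.restrict (Ioc a b)).prod (volume : Measure E)))
    (hsl : ∀ t ∈ Ioc a b, AEStronglyMeasurable (u t) volume) (hM : ∀ t ∈ Ioc a b, ∀ x, ‖u t x‖ ≤ M)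
    {Θ : ℝ → E → E} (hΘ : IsSpaceTimeTestOn (⊤ : Opens (ℝ × E)) Θ) :
    Integrable (fun q : ℝ × E => ⟪u q.1 q.2, Θ q.1 q.2⟫)
      ((volume.restrict (Ioc a b)).prod (volume : Measure E)) := by
  haveI : IsFiniteMeasure (volume.restrict (Ioc a b)) :=
    isFiniteMeasure_restrict.2 measure_Ioc_lt_top.ne
  obtain ⟨M₁, -, hM₁⟩ := hΘ.exists_integral_norm_slice_le
  have hΘm : AEStronglyMeasurable (uncurry Θ) ((volume.restrict (Ioc a b)).prod (volume : Measure E)) :=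
    hΘ.continuous_uncurry.aestronglyMeasurable
  have hFm : AEStronglyMeasurable (fun q : ℝ × E => ⟪u q.1 q.2, Θ q.1 q.2⟫)
      ((volume.restrict (Ioc a b)).prod (volume : Measure E)) := hmeas.inner hΘm
  rw [integrable_prod_iff hFm]
  constructor
  · refine (ae_restrict_iff' measurableSet_Ioc).2 (Eventually.of_forall fun t ht => ?_)
    exact integrable_inner_of_aestronglyMeasurable_of_norm_le (hsl t ht) (hM t ht)
      ((hΘ.contDiff_slice t).continuous.integrable_of_hasCompactSupport (hΘ.hasCompactSupport_slice t))
  · refine Integrable.mono' (integrable_const (max M 0 * M₁)) hFm.norm.integral_prod_right' ?_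
    refine (ae_restrict_iff' measurableSet_Ioc).2 (Eventually.of_forall fun t ht => ?_)
    rw [Real.norm_of_nonneg (integral_nonneg fun _ => norm_nonneg _)]
    have hi : Integrable (Θ t) volume :=
      (hΘ.contDiff_slice t).continuous.integrable_of_hasCompactSupport (hΘ.hasCompactSupport_slice t)
    calc ∫ x, ‖⟪u t x, Θ t x⟫‖ ≤ ∫ x, max M 0 * ‖Θ t x‖ := by
          refine integral_mono_of_nonneg (Eventually.of_forall fun _ => norm_nonneg _)
            (hi.norm.const_mul _) (Eventually.of_forall fun x => ?_)
          exact (norm_inner_le_norm _ _).trans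
            (mul_le_mul_of_nonneg_right ((hM t ht x).trans (le_max_left _ _)) (norm_nonneg _))
      _ = max M 0 * ∫ x, ‖Θ t x‖ := integral_const_mul _ _
      _ ≤ max M 0 * M₁ := mul_le_mul_of_nonneg_left (hM₁ t) (le_max_right _ _)

/-- **Slab integrability of the transport pairing** `(t, x) ↦ ⟪u t x, DΘ(t)(x) u t x⟫` of a
bounded jointly measurable field with the gradient of a space–time test field on `(a, b] × E`. [folklore] -/
theorem integrable_prod_inner_convect_test_of_norm_le {a b : ℝ} {M : ℝ}
    (hmeas : AEStronglyMeasurable (uncurry u) ((volume.restrict (Ioc a b)).prod (volume : Measure E)))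
    (hsl : ∀ t ∈ Ioc a b, AEStronglyMeasurable (u t) volume) (hM : ∀ t ∈ Ioc a b, ∀ x, ‖u t x‖ ≤ M)
    {Θ : ℝ → E → E} (hΘ : IsSpaceTimeTestOn (⊤ : Opens (ℝ × E)) Θ) :
    Integrable (fun q : ℝ × E => ⟪u q.1 q.2, fderiv ℝ (Θ q.1) q.2 (u q.1 q.2)⟫)
      ((volume.restrict (Ioc a b)).prod (volume : Measure E)) := by
  haveI : IsFiniteMeasure (volume.restrict (Ioc a b)) :=
    isFiniteMeasure_restrict.2 measure_Ioc_lt_top.ne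
  have hΘ' : IsSpaceTimeTestOn (⊤ : Opens (ℝ × E)) (fun t x => fderiv ℝ (Θ t) x) := hΘ.fderiv_top
  obtain ⟨M₁, -, hM₁⟩ := hΘ'.exists_integral_norm_slice_le
  have happ := (isBoundedBilinearMap_apply (𝕜 := ℝ) (E := E) (F := E)).continuous
  have hΘm : AEStronglyMeasurable (uncurry fun t x => fderiv ℝ (Θ t) x)
      ((volume.restrict (Ioc a b)).prod (volume : Measure E)) :=
    hΘ'.continuous_uncurry.aestronglyMeasurable
  have hFm : AEStronglyMeasurable (fun q : ℝ × E => ⟪u q.1 q.2, fderiv ℝ (Θ q.1) q.2 (u q.1 q.2)⟫)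
      ((volume.restrict (Ioc a b)).prod (volume : Measure E)) :=
    hmeas.inner (happ.comp_aestronglyMeasurable (hΘm.prodMk hmeas))
  have hsl' : ∀ t ∈ Ioc a b, Integrable (fun x => ⟪u t x, fderiv ℝ (Θ t) x (u t x)⟫) volume ∧
      ∫ x, ‖⟪u t x, fderiv ℝ (Θ t) x (u t x)⟫‖ ≤ M ^ 2 * M₁ := fun t ht => by
    have hi : Integrable (fun x => fderiv ℝ (Θ t) x) volume :=
      (hΘ'.contDiff_slice t).continuous.integrable_of_hasCompactSupport (hΘ'.hasCompactSupport_slice t)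
    obtain ⟨h1, h2⟩ := integrable_inner_clm_apply_of_norm_le (hsl t ht) (hM t ht) hi
    exact ⟨h1, h2.trans (mul_le_mul_of_nonneg_left (hM₁ t) (sq_nonneg M))⟩
  rw [integrable_prod_iff hFm]
  constructor
  · exact (ae_restrict_iff' measurableSet_Ioc).2 (Eventually.of_forall fun t ht => (hsl' t ht).1)
  · refine Integrable.mono' (integrable_const (M ^ 2 * M₁)) hFm.norm.integral_prod_right' ?_
    refine (ae_restrict_iff' measurableSet_Ioc).2 (Eventually.of_forall fun t ht => ?_)
    rw [Real.norm_of_nonneg (integral_nonneg fun _ => norm_nonneg _)]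
    exact (hsl' t ht).2

/-- **Bounded ancient mild solutions are bounded weak solutions** (mild ⇒ weak in `L^∞`;
Koch–Nadirashvili–Seregin–Šverák 2009, §4 (i)–(ii), arXiv:0709.3599 p. 8: the notions of mild
and weak solution in `L^∞(ℝⁿ × (0, T))`, "the considerations of the previous section [mild
solutions are particular weak solutions, Lemma 3.1] can be repeated with `f_k = -u_k u`";
Fabes–Jones–Rivière 1972, Thm. 2.1, (ii) ⇒ (i) for the duality formulation). Let `u` be a
bounded ancient mild solution of Navier–Stokes in the tree's duality form
(`Fluid.IsBoundedAncientMildSolution ν u`, `0 < ν`: slices weakly divergence free for `t < 0`,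
the two-time identity against the caloric test fields `e^{ν(t-τ)Δ}φ`, `φ ∈ C_c^∞` divergence
free, between all `s < t < 0`, and a uniform bound), which is jointly a.e. strongly measurable on
`(-∞, 0) × E` with measurable slices. Then `u` is a bounded weak solution on `ℝⁿ × (-∞, 0)` in
the sense of KNSS (`Fluid.IsBoundedWeakNSSolutionOn`): for every smooth compactly supported
`ψ` on the open slab with divergence-free slices,
`∫_{t<0} ∫ (⟪u, ∂ₜψ⟫ + ⟪u, (u·∇)ψ⟫ + ν⟪u, Δψ⟫) dx dt = 0`.
Proof: with `Λ = ∂ₜψ + νΔψ` (divergence-free slices) and a base time `a` below the time support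
of `ψ`, the two-time identity between `a` and `t` tested with `Λ(t)` is integrated over
`t ∈ (a, b]`; the free term gives `⟨u(a), 𝒰[Λ](a)⟩ = -⟨u(a), ψ(a)⟩ = 0` and the nonlinear term,
after Fubini on the slab, `∫⟨u ⊗ u, ∇𝒰[Λ]⟩ dτ = -∫⟨u, (u·∇)ψ⟩ dτ`, by the backward heat equation
`𝒰[∂ₜψ + νΔψ] = -ψ` for the backward caloric Duhamel integral `𝒰`. [cite: KochNadirashviliSereginSverak2009, §4 (i)–(ii) (arXiv:0709.3599 p. 8)] -/
theorem IsBoundedAncientMildSolution.isBoundedWeakNSSolutionOn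
    (hu : IsBoundedAncientMildSolution ν u) (hν : 0 < ν)
    (hmeas : AEStronglyMeasurable (uncurry u) ((volume : Measure (ℝ × E)).restrict (Iio 0 ×ˢ univ)))
    (hsl : ∀ t < 0, AEStronglyMeasurable (u t) volume) :
    IsBoundedWeakNSSolutionOn (Iio 0) isOpen_Iio ν u := by
  obtain ⟨M, hM'⟩ := hu.2
  have hM : ∀ t < 0, ∀ x, ‖u t x‖ ≤ M := fun t ht x => hM' t ht x
  refine ⟨hmeas, hu.2, ?_, fun ψ hψ hdiv => ?_⟩
  · exact (ae_restrict_iff' measurableSet_Iio).2 (Eventually.of_forall fun t ht => hu.1.1 t ht)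
  -- time support of the test field: `[a', b]`, `b < 0`; base time `a = a' - 1`
  obtain ⟨a', b, ha'b, hb0, hsupp⟩ := hψ.exists_time_support_lt
  have hψ' : IsSpaceTimeTestOn (⊤ : Opens (ℝ × E)) ψ := hψ.mono le_top
  set a : ℝ := a' - 1 with ha_def
  have haa' : a < a' := by rw [ha_def]; linarith
  have hab : a ≤ b := by rw [ha_def]; linarith
  have ha0 : a < 0 := by rw [ha_def]; linarith
  -- the adjoint field `Λ = ∂ₜψ + νΔψ`
  set Λ : ℝ → E → E := fun t x => timeDeriv ψ t x + ν • Δ (ψ t) x with hΛ_def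
  have hΛ : IsSpaceTimeTestOn (⊤ : Opens (ℝ × E)) Λ := hψ'.heatAdjointField_top ν
  have hΛd : ∀ t, VectorCalculus.IsDivFree (Λ t) := fun t => hψ'.isDivFree_heatAdjointField hdiv ν t
  have hΛsupp : ∀ t, t ∉ Icc a' b → Λ t = 0 := fun t ht =>
    heatAdjointField_eq_zero_of_time_support hsupp ν ht
  have hmeas' : AEStronglyMeasurable (uncurry u) ((volume.restrict (Ioc a b)).prod (volume : Measure E)) :=
    aestronglyMeasurable_uncurry_restrict_Ioc_of_Iio hb0 hmeas
  have haτ : ∀ τ ∈ Icc a b, AEStronglyMeasurable (u τ) volume := fun τ hτ => hsl τ (hτ.2.trans_lt hb0)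
  have haM : ∀ τ ∈ Icc a b, ∀ x, ‖u τ x‖ ≤ M := fun τ hτ => hM τ (hτ.2.trans_lt hb0)
  have haτ' : ∀ τ ∈ Ioc a b, AEStronglyMeasurable (u τ) volume := fun τ hτ => haτ τ (Ioc_subset_Icc_self hτ)
  have haM' : ∀ τ ∈ Ioc a b, ∀ x, ‖u τ x‖ ≤ M := fun τ hτ => haM τ (Ioc_subset_Icc_self hτ)
  -- (1) slab duality for `Λ`: `∫ (⟨u(t), Λ(t)⟩ - ⟨u(a), e^{ν(t-a)Δ}Λ(t)⟩) dt = ∫ ⟨u ⊗ u, D𝒰[Λ]⟩ dτ`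
  obtain ⟨R, -, hK1⟩ := hΛ.exists_integral_norm_transportKernel_le hν
  have h1 : ∫ t in Ioc a b, ((∫ x, ⟪u t x, Λ t x⟫) - ∫ x, ⟪u a x, heatTest ν (Λ t) (t - a) x⟫) =
      ∫ τ in Ioc a b, ∫ x, ⟪u τ x, fderiv ℝ (heatDuhamelBack ν Λ τ) x (u τ x)⟫ :=
    setIntegral_slab_duality_of_norm_le (a := u)
      (K := fun (t' : ℝ) (y : ℝ × E) => if y.1 < t' then fderiv ℝ (heatTest ν (Λ t') (t' - y.1)) y.2 else 0)
      hab hK1 (hΛ.aestronglyMeasurable_transportKernel hν _)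
      (fun t => hΛ.aestronglyMeasurable_transportKernel_slice hν t _) hmeas' haτ haM
      (fun t ht => hu.1.integral_inner_sub_eq_slab hν hM hsl hab hb0 hmeas' hΛ hΛd ht)
      (fun y hy => ⟨hΛ.integrableOn_transportKernel_time hν a b y.1 y.2,
        hΛ.setIntegral_transportKernel_eq_fderiv_heatDuhamelBack hν hΛsupp le_rfl
          (Ioc_subset_Icc_self hy) y.2⟩)
  -- (2) `D𝒰[Λ](τ) = -Dψ(τ)` by the backward heat equation
  have h2 : ∀ τ x, fderiv ℝ (heatDuhamelBack ν Λ τ) x = -fderiv ℝ (ψ τ) x := fun τ x => by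
    have h : heatDuhamelBack ν Λ τ = -(ψ τ) :=
      funext fun y => hψ'.heatDuhamelBack_heatAdjointField hν τ y
    rw [h, fderiv_neg]
  -- (3) the free term vanishes
  have h3 : ∫ t in Ioc a b, ∫ x, ⟪u a x, heatTest ν (Λ t) (t - a) x⟫ = 0 :=
    integral_integral_inner_heatTest_heatAdjointField_eq_zero hν (hsl a ha0) (hM a ha0) hψ' hsupp
      haa' hab le_rfl
  -- integrability in `t` of the slice pairings on `(a, b]`
  have hP : Integrable (fun t => ∫ x, ⟪u t x, Λ t x⟫) (volume.restrict (Ioc a b)) :=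
    (integrable_prod_inner_test_of_norm_le hmeas' haτ' haM' hΛ).integral_prod_left
  have hQ : Integrable (fun t => ∫ x, ⟪u t x, fderiv ℝ (ψ t) x (u t x)⟫) (volume.restrict (Ioc a b)) :=
    (integrable_prod_inner_convect_test_of_norm_le hmeas' haτ' haM' hψ').integral_prod_left
  have hT : Integrable (fun t => ∫ y, ⟪u y.1 y.2,
      (if y.1 < t then fderiv ℝ (heatTest ν (Λ t) (t - y.1)) y.2 else 0) (u y.1 y.2)⟫
        ∂((volume.restrict (Ioc a b)).prod (volume : Measure E))) (volume.restrict (Ioc a b)) :=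
    (integrable_transportIntegrand_of_norm_le (a := u)
      (K := fun (t' : ℝ) (y : ℝ × E) => if y.1 < t' then fderiv ℝ (heatTest ν (Λ t') (t' - y.1)) y.2 else 0)
      hab hK1 (hΛ.aestronglyMeasurable_transportKernel hν _)
      (fun t => hΛ.aestronglyMeasurable_transportKernel_slice hν t _) hmeas' haτ haM).integral_prod_left
  have hPL : Integrable (fun t => (∫ x, ⟪u t x, Λ t x⟫) - ∫ x, ⟪u a x, heatTest ν (Λ t) (t - a) x⟫)
      (volume.restrict (Ioc a b)) := by
    refine hT.congr ?_
    refine (ae_restrict_iff' measurableSet_Ioc).2 (Eventually.of_forall fun t ht => ?_)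
    exact (hu.1.integral_inner_sub_eq_slab hν hM hsl hab hb0 hmeas' hΛ hΛd ht).symm
  have hLt : Integrable (fun t => ∫ x, ⟪u a x, heatTest ν (Λ t) (t - a) x⟫)
      (volume.restrict (Ioc a b)) := by
    refine (hP.sub hPL).congr (Eventually.of_forall fun t => ?_)
    simp only [Pi.sub_apply]
    ring
  -- (4) `∫ ⟨u, Λ⟩ dt = -∫ ⟨u, (u·∇)ψ⟩ dt`
  have h4 : ∫ t in Ioc a b, ∫ x, ⟪u t x, Λ t x⟫ =
      -∫ t in Ioc a b, ∫ x, ⟪u t x, fderiv ℝ (ψ t) x (u t x)⟫ := by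
    have e : (fun t => ∫ x, ⟪u t x, Λ t x⟫) = fun t =>
        ((∫ x, ⟪u t x, Λ t x⟫) - ∫ x, ⟪u a x, heatTest ν (Λ t) (t - a) x⟫) +
          ∫ x, ⟪u a x, heatTest ν (Λ t) (t - a) x⟫ := by
      funext t; ring
    rw [e, integral_add hPL hLt, h3, add_zero, h1, ← integral_neg]
    refine setIntegral_congr_fun measurableSet_Ioc fun τ _ => ?_
    rw [← integral_neg]
    refine integral_congr_ae (Eventually.of_forall fun x => ?_)
    show ⟪u τ x, fderiv ℝ (heatDuhamelBack ν Λ τ) x (u τ x)⟫ = -⟪u τ x, fderiv ℝ (ψ τ) x (u τ x)⟫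
    rw [h2, neg_apply, inner_neg_right]
  -- (5) reduce the weak identity to `(a, b]` and conclude
  have hvan : ∀ t ∈ Iio (0 : ℝ) \ Ioc a b,
      (∫ x, (⟪u t x, timeDeriv ψ t x⟫ + ⟪u t x, convect (u t) (ψ t) x⟫ + ν * ⟪u t x, Δ (ψ t) x⟫)) = 0 := by
    intro t ht
    have ht' : t ∉ Icc a' b := fun h => ht.2 ⟨by linarith [h.1], h.2⟩
    have hψt : ψ t = 0 := hsupp t ht'
    have hdt : timeDeriv ψ t = 0 := timeDeriv_eq_zero_of_time_support hsupp ht'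
    have hdt' : ∀ x, deriv (fun s => ψ s x) t = 0 := fun x => by
      have h := congrFun hdt x
      simpa [timeDeriv] using h
    have hΔt : Δ (ψ t) = 0 := by
      rw [hψt]
      exact InnerProductSpace.laplacian_const (E := E) (c := (0 : E))
    have hDt : ∀ x, fderiv ℝ (ψ t) x = 0 := fun x => by
      rw [hψt]
      exact fderiv_const_apply 0
    simp [hdt', hΔt, hDt]
  rw [setIntegral_eq_of_subset_of_forall_sdiff_eq_zero (s := Ioc a b) measurableSet_Iio
    (fun t ht => (ht.2.trans_lt hb0 : t < 0)) hvan]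
  have e5 : ∀ t ∈ Ioc a b,
      (∫ x, (⟪u t x, timeDeriv ψ t x⟫ + ⟪u t x, convect (u t) (ψ t) x⟫ + ν * ⟪u t x, Δ (ψ t) x⟫)) =
        (∫ x, ⟪u t x, Λ t x⟫) + ∫ x, ⟪u t x, fderiv ℝ (ψ t) x (u t x)⟫ := by
    intro t ht
    have ht0 : t < 0 := ht.2.trans_lt hb0
    have iP : Integrable (fun x => ⟪u t x, Λ t x⟫) volume :=
      integrable_inner_of_aestronglyMeasurable_of_norm_le (hsl t ht0) (hM t ht0)
        ((hΛ.contDiff_slice t).continuous.integrable_of_hasCompactSupport (hΛ.hasCompactSupport_slice t))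
    have iQ : Integrable (fun x => ⟪u t x, fderiv ℝ (ψ t) x (u t x)⟫) volume :=
      (integrable_inner_clm_apply_of_norm_le (hsl t ht0) (hM t ht0)
        ((hψ'.fderiv_top.contDiff_slice t).continuous.integrable_of_hasCompactSupport
          (hψ'.fderiv_top.hasCompactSupport_slice t))).1
    rw [← integral_add iP iQ]
    refine integral_congr_ae (Eventually.of_forall fun x => ?_)
    simp only [hΛ_def, inner_add_right, real_inner_smul_right, convect_apply]
    ring
  rw [setIntegral_congr_fun measurableSet_Ioc e5, integral_add hP hQ, h4, neg_add_cancel]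

end Main

end Literature.Analysis.FluidPDE
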